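import Literature.Topology.FourManifolds.LinkingNumberWellDefined
import HarnessLib

/-!
# The framing of a tubular neighbourhood can be read at any radius; transfer of framings

Topic `Literature/Topology/FourManifolds`; first file of the proof of the named fact
`Literature.Topology.FourManifolds.nonempty_diffeomorph_of_isIntegralSurgery` (`DehnSurgery.lean`:
uniqueness of integral Dehn surgery on a knot up to diffeomorphism; Gompf–Stipsicz,
*4-Manifolds and Kirby Calculus* (1999), §5.3; Rolfsen, *Knots and Links* (1976), §9.F–G).
Everything in this file is proved; no definition and no named fact is introduced.

Recall (`DehnSurgery.lean`) that an oriented tubular neighbourhood `ν : 𝕊¹ × ℝ² ↪ 𝕊³` of a knot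
`K` **has framing `m`** (`Knot.TubularNbhd.HasFraming ν m`) when `[λ] = m • [μ]` in the abelianised
knot group `π₁(S³ ∖ K, p₀)ᵃᵇ`, where the meridian `μ : t ↦ ν (x₀, ½ e^{2πit})` and the longitude
`λ : t ↦ ν (e^{2πit}, (½, 0))` are read on the torus of radius `½`, based at `p₀ = ν (x₀, (½, 0))`.
We prove:

* `Knot.TubularNbhd.hasFraming_iff_of_loops` — **the framing can be read at any radius**: for
  every `r > 0` and loops `L`, `M` in `S³ ∖ K` tracing the longitude `t ↦ ν (e^{2πit}, (r, 0))` and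
  the meridian `t ↦ ν (x₀, r e^{2πit})` of radius `r`, `ν.HasFraming m ↔ [L] = m • [M]` in
  `π₁(S³ ∖ K, ν (x₀, (r, 0)))ᵃᵇ` (`L`, `M` are conjugate to `λ`, `μ` by the radial homotopies in the
  punctured tube; conjugate loops have the same image in the abelianisation after any change of
  base point, `LoopConj.abelianizationOf_eq` of `LinkingNumberWellDefined.lean`, and the change of
  base point along the conjugating path of the longitude is a group isomorphism);
* `Knot.TubularNbhd.HasFraming.transfer` — **transfer of framings**: if a continuous self-map `G`
  of the knot complement carries the torus of radius `r` of `ν` onto that of `ν'` *identically in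
  the coordinates* (`G (ν (x, w)) = ν' (x, w)` for `‖w‖ = r`), then `ν.HasFraming m → ν'.HasFraming m`
  (the homomorphism induced by `G` on `π₁ᵃᵇ`, Mathlib's `FundamentalGroup.mapOfEq`, maps the
  radius-`r` longitude and meridian of `ν` onto those of `ν'`); in particular
  (`HasFraming.transfer_diffeomorph`) for a diffeomorphism of `𝕊³` fixing `K` pointwise and
  matching `ν` with `ν'` on a torus.

These are the homotopy-theoretic inputs of the uniqueness of Dehn surgery: two tubular
neighbourhoods which agree near the zero section after an ambient diffeomorphism fixing the knot
have the same framing integer (Rolfsen (1976), §9.F: the surgered space only depends on the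
homotopy class of the curve `h(∗ × ∂D²)` in the knot exterior; Gompf–Stipsicz (1999), §5.3).

## References

* D. Rolfsen, *Knots and Links*, Publish or Perish (1976), §9.F–G. [cite: Rolfsen1976, §9.F]
* R. E. Gompf, A. I. Stipsicz, *4-Manifolds and Kirby Calculus*, GSM 20 (1999), §4.5, §5.3.
  [cite: GompfStipsicz1999, §5.3]
* A. Hatcher, *Algebraic Topology* (2002), §1.1 (change of base point; free homotopy classes of
  loops are conjugacy classes). [cite: HatcherAT2002, §1.1]

## Design notes

* No definition is introduced: the loops of radius `r` enter the statements through their values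
  (hypotheses `hL`, `hM`), which is also the form consumed downstream; the tree's
  `Knot.TubularNbhd.smallMeridian` (`LinkingNumberWellDefined.lean`) is one such meridian.
* No local notation and no local instances are declared; `𝕊ⁿ` is written
  `Metric.sphere (0 : EuclideanSpace ℝ (Fin (n + 1))) 1`.
* No declaration in this file uses `sorry`.
-/

noncomputable section

open scoped Manifold ContDiff Topology
open Function Set unitInterval

namespace Literature.Topology.FourManifolds

namespace Knot.TubularNbhd

variable {K : Knot} (ν : Knot.TubularNbhd K)

/-! ### The framing can be read at any radius -/

/-- **The framing can be read at any radius.** Let `r > 0` and let `L`, `M` be loops in the knot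
complement, based at the same point, tracing the longitude `t ↦ ν (e^{2πit}, (r, 0))` and the
meridian `t ↦ ν (x₀, r e^{2πit})` of radius `r` of the oriented tubular neighbourhood `ν`. Then
`ν` has framing `m` iff `[L] = m • [M]` in the abelianised fundamental group at their base point:
`L`, `M` are conjugate to the longitude and the meridian of `ν` (radial homotopies in the
punctured tube, `LoopConj.of_square`), conjugate loops have the same abelianised class after any
change of base point (`LoopConj.abelianizationOf_eq`), and the change of base point along the
conjugating path of the longitude is a group isomorphism. Rolfsen (1976), §9.F (the framing
curve up to homotopy in the knot exterior). [cite: Rolfsen1976, §9.F] -/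
theorem hasFraming_iff_of_loops {m : ℤ} {r : ℝ} (hr : 0 < r) {b : K.complement} (L M : Path b b)
    (hL : ∀ t, ((L t : K.complement) : Metric.sphere (0 : EuclideanSpace ℝ (Fin 4)) 1) =
      ν (circlePoint (2 * Real.pi * t),
        r • ((circlePoint 0 : Metric.sphere (0 : EuclideanSpace ℝ (Fin 2)) 1) : EuclideanSpace ℝ (Fin 2))))
    (hM : ∀ t, ((M t : K.complement) : Metric.sphere (0 : EuclideanSpace ℝ (Fin 4)) 1) =
      ν (circlePoint 0,
        r • ((circlePoint (2 * Real.pi * t) : Metric.sphere (0 : EuclideanSpace ℝ (Fin 2)) 1) :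
          EuclideanSpace ℝ (Fin 2)))) :
    ν.HasFraming m ↔
      Abelianization.of (FundamentalGroup.fromPath (Path.Homotopic.Quotient.mk L)) =
        Abelianization.of (FundamentalGroup.fromPath (Path.Homotopic.Quotient.mk M)) ^ m := by
  -- radii `ρ_s = (1 - s)/2 + s r > 0`
  have hρ : ∀ s : I, (1 - (s : ℝ)) / 2 + s * r ≠ 0 := fun s => by
    have h0 : (0 : ℝ) ≤ s := s.2.1
    have h1 : (s : ℝ) ≤ 1 := s.2.2
    have : 0 < (1 - (s : ℝ)) / 2 + s * r := by
      rcases eq_or_lt_of_le h0 with h | h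
      · rw [← h]; norm_num
      · nlinarith
    exact this.ne'
  -- the longitude is conjugate to `L`
  have hcL : LoopConj ν.longitude L := by
    let F : C(I × I, K.complement) :=
      ⟨fun x => ⟨ν (circlePoint (2 * Real.pi * x.2), (((1 - (x.1 : ℝ)) / 2 + x.1 * r) •
          ((circlePoint 0 : Metric.sphere (0 : EuclideanSpace ℝ (Fin 2)) 1) :
            EuclideanSpace ℝ (Fin 2)))),
          ν.apply_mem_compl_range (smul_circlePoint_ne_zero (hρ x.1) _)⟩, by
        refine Continuous.subtype_mk ?_ _
        fun_prop⟩
    refine LoopConj.of_square F (fun s => ?_) _ _ (fun t => ?_) (fun t => ?_)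
    · apply Subtype.ext
      change ν _ = ν _
      simp only [Set.Icc.coe_zero, Set.Icc.coe_one, mul_zero, mul_one]
      rw [← zero_add (2 * Real.pi), circlePoint_add_two_pi]
    · apply Subtype.ext
      rw [coe_longitude_apply]
      change ν _ = ν _
      simp only [framingBaseVector, Set.Icc.coe_zero, sub_zero, zero_mul, add_zero, one_div]
    · apply Subtype.ext
      rw [hL t]
      change ν _ = ν _
      simp only [Set.Icc.coe_one, sub_self, zero_div, one_mul, zero_add]
  -- the meridian is conjugate to `M`
  have hcM : LoopConj ν.meridian M := by
    let F : C(I × I, K.complement) :=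
      ⟨fun x => ⟨ν (circlePoint 0, (((1 - (x.1 : ℝ)) / 2 + x.1 * r) •
          ((circlePoint (2 * Real.pi * x.2) : Metric.sphere (0 : EuclideanSpace ℝ (Fin 2)) 1) :
            EuclideanSpace ℝ (Fin 2)))),
          ν.apply_mem_compl_range (smul_circlePoint_ne_zero (hρ x.1) _)⟩, by
        refine Continuous.subtype_mk ?_ _
        fun_prop⟩
    refine LoopConj.of_square F (fun s => ?_) _ _ (fun t => ?_) (fun t => ?_)
    · apply Subtype.ext
      change ν _ = ν _
      simp only [Set.Icc.coe_zero, Set.Icc.coe_one, mul_zero, mul_one]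
      rw [← zero_add (2 * Real.pi), circlePoint_add_two_pi]
    · apply Subtype.ext
      rw [coe_meridian_apply]
      change ν _ = ν _
      simp only [Set.Icc.coe_zero, sub_zero, zero_mul, add_zero, one_div]
    · apply Subtype.ext
      rw [hM t]
      change ν _ = ν _
      simp only [Set.Icc.coe_one, sub_self, zero_div, one_mul, zero_add]
  obtain ⟨τ, hτ⟩ := hcL
  -- the change of base point along `τ`, on the abelianisations
  set E := (FundamentalGroup.fundamentalGroupMulEquivOfPath τ).abelianizationCongr with hE
  have hL' : E (Abelianization.of (FundamentalGroup.fromPath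
      (Path.Homotopic.Quotient.mk ν.longitude))) =
      Abelianization.of (FundamentalGroup.fromPath (Path.Homotopic.Quotient.mk L)) := by
    rw [hE, abelianizationCongr_of, fundamentalGroupMulEquivOfPath_fromPath, hτ]
  have hM' : E (Abelianization.of (FundamentalGroup.fromPath
      (Path.Homotopic.Quotient.mk ν.meridian))) =
      Abelianization.of (FundamentalGroup.fromPath (Path.Homotopic.Quotient.mk M)) := by
    rw [hE, abelianizationCongr_of, fundamentalGroupMulEquivOfPath_fromPath]
    exact hcM.abelianizationOf_eq τ
  unfold HasFraming
  rw [← hL', ← hM', ← map_zpow E (Abelianization.of (FundamentalGroup.fromPath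
    (Path.Homotopic.Quotient.mk ν.meridian))) m, E.apply_eq_iff_eq]

/-! ### Transfer of framings along maps of the complement -/

variable {ν}

/-- **Transfer of framings along a map of the knot complement.** Let `ν`, `ν'` be oriented
tubular neighbourhoods of the same knot `K` and `G` a continuous self-map of `S³ ∖ K` which, for
some radius `r > 0`, carries the torus of radius `r` of `ν` to that of `ν'` identically in the
coordinates: `G (ν (x, w)) = ν' (x, w)` whenever `‖w‖ = r`. If `ν` has framing `m`, so has `ν'`:
read the framing of `ν` at radius `r` (`hasFraming_iff_of_loops`), push the relation
`[L] = m • [M]` forward along the homomorphism induced by `G` on `π₁ᵃᵇ`, which maps the radius-`r`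
longitude and meridian of `ν` onto those of `ν'` on the nose, and read back. This is the form in
which "the surgery only depends on the framing curve" enters the uniqueness of Dehn surgery.
Rolfsen (1976), §9.F; Gompf–Stipsicz (1999), §5.3. [cite: Rolfsen1976, §9.F] -/
theorem HasFraming.transfer {ν ν' : Knot.TubularNbhd K} (G : C(K.complement, K.complement))
    {r : ℝ} (hr : 0 < r)
    (hG : ∀ (a : K.complement) (x : Metric.sphere (0 : EuclideanSpace ℝ (Fin 2)) 1)
      (w : EuclideanSpace ℝ (Fin 2)), ‖w‖ = r →
      (a : Metric.sphere (0 : EuclideanSpace ℝ (Fin 4)) 1) = ν (x, w) →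
      (G a : Metric.sphere (0 : EuclideanSpace ℝ (Fin 4)) 1) = ν' (x, w))
    {m : ℤ} (h : ν.HasFraming m) : ν'.HasFraming m := by
  have hnorm : ∀ θ : ℝ, ‖r • ((circlePoint θ : Metric.sphere (0 : EuclideanSpace ℝ (Fin 2)) 1) :
      EuclideanSpace ℝ (Fin 2))‖ = r := fun θ => by
    rw [norm_smul, norm_eq_of_mem_sphere, mul_one, Real.norm_of_nonneg hr.le]
  have h2π : circlePoint (2 * Real.pi) = circlePoint 0 := by
    rw [← zero_add (2 * Real.pi), circlePoint_add_two_pi]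
  -- the longitude and the meridian of radius `r` of `ν`
  let L : Path (ν.fibrePoint _ (smul_circlePoint_ne_zero hr.ne' 0))
      (ν.fibrePoint _ (smul_circlePoint_ne_zero hr.ne' 0)) :=
    { toFun := fun t => ⟨ν (circlePoint (2 * Real.pi * t),
          r • ((circlePoint 0 : Metric.sphere (0 : EuclideanSpace ℝ (Fin 2)) 1) :
            EuclideanSpace ℝ (Fin 2))), ν.apply_mem_compl_range (smul_circlePoint_ne_zero hr.ne' 0)⟩
      continuous_toFun := by
        refine Continuous.subtype_mk ?_ _
        fun_prop
      source' := by
        apply Subtype.ext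
        change ν _ = ν _
        rw [Set.Icc.coe_zero, mul_zero]
      target' := by
        apply Subtype.ext
        change ν _ = ν _
        rw [Set.Icc.coe_one, mul_one, h2π] }
  let M := ν.smallMeridian r hr.ne'
  have hL : ∀ t, ((L t : K.complement) : Metric.sphere (0 : EuclideanSpace ℝ (Fin 4)) 1) =
      ν (circlePoint (2 * Real.pi * t),
        r • ((circlePoint 0 : Metric.sphere (0 : EuclideanSpace ℝ (Fin 2)) 1) :
          EuclideanSpace ℝ (Fin 2))) := fun t => rfl
  have hM : ∀ t, ((M t : K.complement) : Metric.sphere (0 : EuclideanSpace ℝ (Fin 4)) 1) =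
      ν (circlePoint 0,
        r • ((circlePoint (2 * Real.pi * t) : Metric.sphere (0 : EuclideanSpace ℝ (Fin 2)) 1) :
          EuclideanSpace ℝ (Fin 2))) := fun t => rfl
  -- the base points correspond
  have hb : G (ν.fibrePoint _ (smul_circlePoint_ne_zero hr.ne' 0)) =
      ν'.fibrePoint _ (smul_circlePoint_ne_zero hr.ne' 0) :=
    Subtype.ext (hG (ν.fibrePoint _ (smul_circlePoint_ne_zero hr.ne' 0)) (circlePoint 0) _
      (hnorm 0) rfl)
  -- the transported loops are the longitude and the meridian of radius `r` of `ν'`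
  have hL' : ∀ t, ((((L.map G.continuous).cast hb.symm hb.symm) t : K.complement) :
      Metric.sphere (0 : EuclideanSpace ℝ (Fin 4)) 1) =
      ν' (circlePoint (2 * Real.pi * t),
        r • ((circlePoint 0 : Metric.sphere (0 : EuclideanSpace ℝ (Fin 2)) 1) :
          EuclideanSpace ℝ (Fin 2))) := fun t =>
    hG (L t) (circlePoint (2 * Real.pi * t)) _ (hnorm 0) rfl
  have hM' : ∀ t, ((((M.map G.continuous).cast hb.symm hb.symm) t : K.complement) :
      Metric.sphere (0 : EuclideanSpace ℝ (Fin 4)) 1) =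
      ν' (circlePoint 0,
        r • ((circlePoint (2 * Real.pi * t) : Metric.sphere (0 : EuclideanSpace ℝ (Fin 2)) 1) :
          EuclideanSpace ℝ (Fin 2))) := fun t =>
    hG (M t) (circlePoint 0) _ (hnorm _) rfl
  rw [ν.hasFraming_iff_of_loops hr L M hL hM] at h
  rw [ν'.hasFraming_iff_of_loops hr _ _ hL' hM']
  have h' := congrArg (Abelianization.map (FundamentalGroup.mapOfEq G hb)) h
  simpa only [map_zpow, Abelianization.map_of, FundamentalGroup.mapOfEq_apply,
    Path.Homotopic.Quotient.mk_cast, Path.Homotopic.Quotient.mk_map] using h'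

/-- **Transfer of framings along an ambient diffeomorphism fixing the knot.** If a
diffeomorphism `F` of `𝕊³` fixes `K` pointwise and matches two oriented tubular neighbourhoods
`ν`, `ν'` of `K` on the torus of some radius `r > 0` (`F (ν (x, w)) = ν' (x, w)` for `‖w‖ = r`), then
`ν.HasFraming m → ν'.HasFraming m` (`HasFraming.transfer` for the restriction of `F` to the
complement, which `F` preserves because it fixes `K`). Rolfsen (1976), §9.F; Gompf–Stipsicz (1999),
§5.3. [cite: Rolfsen1976, §9.F] -/
theorem HasFraming.transfer_diffeomorph {ν ν' : Knot.TubularNbhd K}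
    (F : (Metric.sphere (0 : EuclideanSpace ℝ (Fin 4)) 1) ≃ₘ⟮𝓡 3, 𝓡 3⟯
      (Metric.sphere (0 : EuclideanSpace ℝ (Fin 4)) 1))
    (hK : ∀ x, F (K x) = K x) {r : ℝ} (hr : 0 < r)
    (hF : ∀ (x : Metric.sphere (0 : EuclideanSpace ℝ (Fin 2)) 1) (w : EuclideanSpace ℝ (Fin 2)),
      ‖w‖ = r → F (ν (x, w)) = ν' (x, w))
    {m : ℤ} (h : ν.HasFraming m) : ν'.HasFraming m := by
  -- the restriction of `F` to the knot complement
  have hmem : ∀ a : K.complement, F a ∈ K.complement := fun a => by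
    rw [SphereEmbedding.mem_complement_iff]
    rintro ⟨y, hy⟩
    rw [← hK] at hy
    exact a.2 ⟨y, F.injective hy⟩
  have hGc : Continuous fun a : K.complement => (⟨F a, hmem a⟩ : K.complement) :=
    (F.continuous.comp continuous_subtype_val).subtype_mk fun a => hmem a
  exact h.transfer ⟨fun a => ⟨F a, hmem a⟩, hGc⟩ hr fun a x w hw ha => by
    change F a = ν' (x, w)
    rw [ha, hF x w hw]

end Knot.TubularNbhd

end Literature.Topology.FourManifolds
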